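import Summits.QuantumFields.YangMills.Theorems.BalabanUVNodesN15PartitionProfile
import HarnessLib

/-!
# THE QUADRATIC PARTITION OF UNITY (2.36), II: the PERIODIZED profile `Θ_K(u) = Θ(u − K·round(u∕K))` on the circle of circumference `K` (the cubes' centres `k ∈ ℤ∕K`):
# `Σ_{k ∈ ℤ∕K} Θ_K(u − k)² = 1` EXACTLY for every real `u` (`K ≥ 2`), `0 ≤ Θ_K ≤ 1`, and the GLOBAL Lipschitz letter `|Θ_K(u) − Θ_K(u′)| ≤ π|u − u′|` (every `K ≥ 1`, through the
# 1-Lipschitz distance to `Kℤ` and the evenness of `Θ`) (dag-n15-c g11, FILE 60; N15 = NE2, s1 «background-layer OPERATOR ingredient»)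

Cell `pub-ymgap`, seat `pub-ymgap-dag-n15-c` (R134 (a); HUMAN RULING D-0062), generation 11.  `bears_on: R4∕N15 · K3⁷ SpineGivenEndpointR13SepCoPH (stmt-QuantumFields-20544)`.
Filed `--supports stmt-QuantumFields-20544 --as helper` — COUNT-NEUTRAL.  Two plumbing `def`s (`cenRep`, `thetaPer`; review-queued, D-0009), the rest theorems; 0 `sorry`.  Imports BY NAME FILE 59
`…N15PartitionProfile` (`thetaP`, `thetaP_partition`, `thetaP_sub_int_ne_zero`, `abs_thetaP_sub_le`, `thetaP_neg`); Mathlib `round_le`, `abs_sub_round`, `ZMod.val_intCast`.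

WHY.  The gluing's cubes sit on a TORUS; the profile of FILE 59 lives on `ℝ`.  Wrapping it around the circle of circumference `K` (= number of cubes per coordinate direction) by the centred
representative `v_K(u) = u − K·round(u∕K) ∈ [−K∕2, K∕2]` gives the periodic profile every lattice partition samples: `h_k(x) = Π_ν Θ_K(ξ_ν(x) − k_ν)` (sequel).  THIS FILE: `cenRep`,
`thetaPer`; `cenRep_add_int_mul` (period `K`), `abs_cenRep_le` (`≤ K∕2`), `abs_cenRep_le_abs_sub` (`round` minimises: `|v_K(u)| ≤ |u − jK|`), ★ `abs_abs_cenRep_sub_le` (`u ↦ |v_K(u)|` is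
1-Lipschitz); `thetaP_abs` (evenness); ★★ `abs_thetaPer_sub_le` — `|Θ_K(u) − Θ_K(u′)| ≤ π|u − u′|` for ALL `u, u′` (so `|∇h| ≤ π∕M` across the seam too); ★ `thetaPer_eq_of_abs_le` (any representative with `|w − jK| ≤ K∕2` gives `Θ_K(w) = Θ(w − jK)`); ★★ `abs_thetaPer_second_diff_le` —
`|Θ_K(u+s) − 2Θ_K(u) + Θ_K(u−s)| ≤ 32π²s²` (`0 ≤ s ≤ 1`, `K ≥ 2`; so `|∇*∇h| ≤ 32π²∕M²` across the seam too); ★★★ `sum_thetaPer_sq` — for `K ≥ 2`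
and every real `u`, `Σ_{k : ZMod K} Θ_K(u − k.val)² = 1`: reduce `u` to `t = v_K(u)`-free form, identify the summand at `k` with `Θ(u − j_k)²` for the integer `j_k ≡ k (mod K)` nearest to
`u`, note that only `j ∈ {⌊u⌋, ⌊u⌋ + 1}` contribute (FILE 59 `thetaP_sub_int_ne_zero`) and that these two classes are distinct mod `K ≥ 2` — then FILE 59 `thetaP_partition`.

HONEST FRAMING ∕ LIMITS.  Elementary; [B6] (2.36) p.229 = the printed requirement (shape); the `d`-dimensional lattice sampling is the sequel.  Nothing of [B6]∕[B9] asserted.  NE2⁺ NOT PRINTED, NOT proved; N15 NOT discharged; counts of record UNMOVED (typed 28∕28 · discharged 5∕27); one finite 𝕋⁴ at fixed ε — NOT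
infinite volume, NOT OS on ℝ⁴, NOT a mass gap, NOT Clay; R4 closes the conditional finite-𝕋⁴ rung `BalabanLadder.UV` only.  Restate-immune (no Theses import).
-/

noncomputable section

namespace Summit.QuantumFields.YangMills.BalabanUVNodes.N15.Gluing

open Real

/-! ## §1 The centred representative modulo `K` -/

/-- The centred representative `v_K(u) = u − K·round(u∕K) ∈ [−K∕2, K∕2]`. [folklore] -/
def cenRep (K : ℕ) (u : ℝ) : ℝ := u - K * (round (u / K) : ℝ)

/-- The periodized profile `Θ_K = Θ ∘ v_K`. [cite: Balaban1984PropagatorsII, (2.36) p.229 (shape)] -/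
def thetaPer (K : ℕ) (u : ℝ) : ℝ := thetaP (cenRep K u)

/-- Period `K`: `v_K(u + jK) = v_K(u)`. [folklore] -/
theorem cenRep_add_int_mul {K : ℕ} (hK : 0 < K) (u : ℝ) (j : ℤ) : cenRep K (u + j * K) = cenRep K u := by
  unfold cenRep
  have hK' : (K : ℝ) ≠ 0 := by exact_mod_cast hK.ne'
  rw [show (u + j * K) / K = u / K + j by field_simp, round_add_intCast]
  push_cast
  ring

/-- `|v_K(u)| ≤ K∕2`. [folklore] -/
theorem abs_cenRep_le {K : ℕ} (hK : 0 < K) (u : ℝ) : |cenRep K u| ≤ K / 2 := by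
  unfold cenRep
  have hKpos : (0 : ℝ) < K := by exact_mod_cast hK
  have h := abs_sub_round (u / K)
  have e : u - K * (round (u / K) : ℝ) = K * (u / K - round (u / K)) := by field_simp
  rw [e, abs_mul, abs_of_pos hKpos]
  calc (K : ℝ) * |u / K - round (u / K)| ≤ K * (1 / 2) := mul_le_mul_of_nonneg_left h hKpos.le
    _ = K / 2 := by ring

/-- `round` minimises: `|v_K(u)| ≤ |u − jK|` for every integer `j`. [folklore] -/
theorem abs_cenRep_le_abs_sub {K : ℕ} (hK : 0 < K) (u : ℝ) (j : ℤ) : |cenRep K u| ≤ |u - j * K| := by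
  unfold cenRep
  have hKpos : (0 : ℝ) < K := by exact_mod_cast hK
  have h := round_le (u / K) j
  have e1 : u - K * (round (u / K) : ℝ) = K * (u / K - round (u / K)) := by field_simp
  have e2 : u - j * K = K * (u / K - j) := by field_simp
  rw [e1, e2, abs_mul, abs_mul, abs_of_pos hKpos]
  exact mul_le_mul_of_nonneg_left h hKpos.le

/-- ★ `u ↦ |v_K(u)|` (the distance to `Kℤ`) is 1-Lipschitz. [folklore] -/
theorem abs_abs_cenRep_sub_le {K : ℕ} (hK : 0 < K) (u u' : ℝ) : |(|cenRep K u| - |cenRep K u'|)| ≤ |u - u'| := by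
  have key : ∀ u u' : ℝ, |cenRep K u'| ≤ |u' - u| + |cenRep K u| := by
    intro u u'
    have h := abs_cenRep_le_abs_sub hK u' (round (u / K))
    have e : u' - (round (u / K) : ℤ) * (K : ℝ) = (u' - u) + cenRep K u := by unfold cenRep; ring
    rw [e] at h
    exact h.trans (abs_add_le _ _)
  rw [abs_le]
  constructor
  · have := key u u'; rw [abs_sub_comm] at this; linarith
  · have := key u' u; linarith

/-! ## §2 The periodized profile -/

/-- `Θ(|v|) = Θ(v)`. [folklore] -/
theorem thetaP_abs (v : ℝ) : thetaP |v| = thetaP v := by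
  rcases le_or_gt 0 v with h | h
  · rw [abs_of_nonneg h]
  · rw [abs_of_neg h, thetaP_neg]

/-- Period `K`. [folklore] -/
theorem thetaPer_add_int_mul {K : ℕ} (hK : 0 < K) (u : ℝ) (j : ℤ) : thetaPer K (u + j * K) = thetaPer K u := by
  unfold thetaPer; rw [cenRep_add_int_mul hK]

/-- `0 ≤ Θ_K ≤ 1`. [folklore] -/
theorem thetaPer_nonneg (K : ℕ) (u : ℝ) : 0 ≤ thetaPer K u := thetaP_nonneg _

/-- `|Θ_K| ≤ 1`. [folklore] -/
theorem abs_thetaPer_le_one (K : ℕ) (u : ℝ) : |thetaPer K u| ≤ 1 := abs_thetaP_le_one _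

/-- ★★ **THE GLOBAL LIPSCHITZ LETTER ON THE CIRCLE**: `|Θ_K(u) − Θ_K(u′)| ≤ π|u − u′|` for all `u, u′` and every `K ≥ 1` — across the seam too (evenness of `Θ`).
[cite: Balaban1984PropagatorsII, (2.36) p.229 («|∂h_□| ≤ O(1)M⁻¹»: shape)] -/
theorem abs_thetaPer_sub_le {K : ℕ} (hK : 0 < K) (u u' : ℝ) : |thetaPer K u - thetaPer K u'| ≤ π * |u - u'| := by
  unfold thetaPer
  rw [← thetaP_abs (cenRep K u), ← thetaP_abs (cenRep K u')]
  exact (abs_thetaP_sub_le _ _).trans (mul_le_mul_of_nonneg_left (abs_abs_cenRep_sub_le hK u u') Real.pi_pos.le)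

/-- ★ **ANY centred representative will do**: `|w − jK| ≤ K∕2 ⟹ Θ_K(w) = Θ(w − jK)` (two representatives of absolute value `≤ K∕2` are equal or `±K∕2`, and `Θ` is even). [folklore] -/
theorem thetaPer_eq_of_abs_le {K : ℕ} (hK : 0 < K) {w : ℝ} {j : ℤ} (hj : |w - j * K| ≤ K / 2) : thetaPer K w = thetaP (w - j * K) := by
  unfold thetaPer
  have hKr : (0 : ℝ) < K := by exact_mod_cast hK
  have hv := abs_cenRep_le hK w
  -- the two representatives differ by an integer multiple of K
  have hdiff : cenRep K w - (w - j * K) = ((j - round (w / K) : ℤ) : ℝ) * K := by unfold cenRep; push_cast; ring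
  set m : ℤ := j - round (w / K) with hm
  have hmK : |(m : ℝ) * K| ≤ K := by
    rw [← hdiff]
    calc |cenRep K w - (w - j * K)| ≤ |cenRep K w| + |w - j * K| := abs_sub _ _
      _ ≤ K / 2 + K / 2 := add_le_add hv hj
      _ = K := by ring
  have hm1 : |(m : ℝ)| ≤ 1 := by
    rw [abs_mul, abs_of_pos hKr] at hmK
    nlinarith [abs_nonneg (m : ℝ)]
  have hm_cases : m = 0 ∨ m = 1 ∨ m = -1 := by
    have h1 : (m : ℝ) ≤ 1 := (le_abs_self _).trans hm1
    have h2 : (-1 : ℝ) ≤ m := by linarith [neg_abs_le (m : ℝ)]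
    have h1' : m ≤ 1 := by exact_mod_cast h1
    have h2' : -1 ≤ m := by exact_mod_cast h2
    omega
  rcases hm_cases with h0 | h1 | h1
  · rw [h0] at hdiff; push_cast at hdiff; rw [zero_mul, sub_eq_zero] at hdiff; rw [hdiff]
  · -- cenRep = (w − jK) + K: both of absolute value ≤ K/2 ⟹ w − jK = −K/2, cenRep = K/2
    rw [h1] at hdiff; push_cast at hdiff; rw [one_mul] at hdiff
    have e1 : w - j * K = -(K / 2) := by
      have := abs_le.1 hj; have := abs_le.1 hv; linarith
    have e2 : cenRep K w = K / 2 := by linarith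
    rw [e2, e1, thetaP_neg]
  · rw [h1] at hdiff; push_cast at hdiff
    have e1 : w - j * K = K / 2 := by
      have := abs_le.1 hj; have := abs_le.1 hv; linarith
    have e2 : cenRep K w = -(K / 2) := by linarith
    rw [e2, e1, thetaP_neg]

/-- Flatness in absolute-value form: `1 − 2s ≤ |w|`, `s ≤ 1` ⟹ `Θ(w) ≤ 8π²s²`. [folklore] -/
theorem thetaP_le_of_le_abs {w s : ℝ} (hs1 : s ≤ 1) (hw : 1 - 2 * s ≤ |w|) : thetaP w ≤ 8 * π ^ 2 * s ^ 2 := by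
  by_cases h1 : 1 ≤ |w|
  · rw [thetaP_eq_zero_of_one_le_abs h1]; positivity
  · push Not at h1
    rw [← thetaP_abs, show |w| = 1 - (1 - |w|) by ring]
    refine (thetaP_one_sub_le (u := 1 - |w|) (by linarith) (by linarith [abs_nonneg w])).trans ?_
    have : (1 - |w|) ^ 2 ≤ (2 * s) ^ 2 := pow_le_pow_left₀ (by linarith) (by linarith) 2
    nlinarith [Real.pi_pos, sq_nonneg π]

/-- ★★ **THE SECOND-DIFFERENCE LETTER ON THE CIRCLE**: `|Θ_K(u+s) − 2Θ_K(u) + Θ_K(u−s)| ≤ 32π²s²` for `0 ≤ s ≤ 1`, `K ≥ 2` (interior: FILE 59's `12π²s²` on a common representative;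
near the seam: all three values `≤ 8π²s²` by flatness). [cite: Balaban1984PropagatorsII, (2.36) p.229 («|∂²h_□| ≤ O(1)M⁻²»: shape)] -/
theorem abs_thetaPer_second_diff_le {K : ℕ} (hK : 2 ≤ K) {u s : ℝ} (hs : 0 ≤ s) (hs1 : s ≤ 1) :
    |thetaPer K (u + s) - 2 * thetaPer K u + thetaPer K (u - s)| ≤ 32 * π ^ 2 * s ^ 2 := by
  have hK0 : 0 < K := by omega
  have hKr : (0 : ℝ) < K := by exact_mod_cast hK0
  have hK2 : (2 : ℝ) ≤ K := by exact_mod_cast hK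
  set j : ℤ := round (u / K) with hj
  have hv : |u - j * K| ≤ K / 2 := by
    have := abs_cenRep_le hK0 u; unfold cenRep at this; rwa [mul_comm] at this
  by_cases hin : |u - j * K| ≤ K / 2 - s
  · -- interior: a common representative for the three points
    have hp : |u + s - j * K| ≤ K / 2 := by
      rw [show u + s - j * K = (u - j * K) + s by ring]; refine (abs_add_le _ _).trans ?_; rw [abs_of_nonneg hs]; linarith
    have hm : |u - s - j * K| ≤ K / 2 := by
      rw [show u - s - j * K = (u - j * K) - s by ring]; refine (abs_sub _ _).trans ?_; rw [abs_of_nonneg hs]; linarith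
    rw [thetaPer_eq_of_abs_le hK0 hp, thetaPer_eq_of_abs_le hK0 hv, thetaPer_eq_of_abs_le hK0 hm,
      show u + s - j * K = (u - j * K) + s by ring, show u - s - j * K = (u - j * K) - s by ring]
    exact (abs_thetaP_second_diff_le (t := u - j * K) hs hs1).trans (by nlinarith [Real.pi_pos, sq_nonneg π, sq_nonneg s])
  · -- near the seam: every value is ≤ 8π²s²
    push Not at hin
    have hfar : ∀ w : ℝ, |w - u| ≤ s → thetaPer K w ≤ 8 * π ^ 2 * s ^ 2 := by
      intro w hw
      unfold thetaPer
      have hlip := abs_abs_cenRep_sub_le hK0 w u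
      have hcu : |cenRep K u| = |u - j * K| := by unfold cenRep; rw [mul_comm]
      have h1 : 1 - 2 * s ≤ |cenRep K w| := by
        have := abs_le.1 hlip
        linarith [hw]
      exact thetaP_le_of_le_abs hs1 h1
    have b1 := hfar (u + s) (by rw [show u + s - u = s by ring, abs_of_nonneg hs])
    have b2 := hfar u (by rw [sub_self, abs_zero]; exact hs)
    have b3 := hfar (u - s) (by rw [show u - s - u = -s by ring, abs_neg, abs_of_nonneg hs])
    have p1 := thetaPer_nonneg K (u + s)
    have p2 := thetaPer_nonneg K u
    have p3 := thetaPer_nonneg K (u - s)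
    rw [abs_le]; constructor <;> nlinarith

/-! ## §3 The exact partition on the circle -/

/-- The summand at `k`: `Θ_K(u − k) = Θ(u − j)` with `j = k + K·round((u − k)∕K)`. [folklore] -/
theorem thetaPer_sub_eq (K : ℕ) (u : ℝ) (k : ℕ) : thetaPer K (u - k) = thetaP (u - ((k : ℤ) + (K : ℤ) * round ((u - k) / K) : ℤ)) := by
  unfold thetaPer cenRep
  push_cast
  ring_nf

/-- ★★★ **THE PARTITION ON THE CIRCLE**: for `K ≥ 2` and every real `u`, `Σ_{k ∈ ℤ∕K} Θ_K(u − k)² = 1`. [cite: Balaban1984PropagatorsII, (2.36) p.229] -/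
theorem sum_thetaPer_sq {K : ℕ} [NeZero K] (hK : 2 ≤ K) (u : ℝ) : ∑ k : ZMod K, thetaPer K (u - (k.val : ℝ)) ^ 2 = 1 := by
  have hK0 : 0 < K := by omega
  have hKr : (0 : ℝ) < K := by exact_mod_cast hK0
  have hKr2 : (2 : ℝ) ≤ K := by exact_mod_cast hK
  haveI : Fact (1 < K) := ⟨by omega⟩
  -- the integer attached to a class
  set J : ZMod K → ℤ := fun k => (k.val : ℤ) + (K : ℤ) * round ((u - k.val) / K) with hJ
  have hsummand : ∀ k : ZMod K, thetaPer K (u - (k.val : ℝ)) = thetaP (u - (J k : ℝ)) := fun k => by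
    rw [hJ]; exact thetaPer_sub_eq K u k.val
  have hcastJ : ∀ k : ZMod K, ((J k : ℤ) : ZMod K) = k := fun k => by
    rw [hJ]; push_cast; rw [ZMod.natCast_self, zero_mul, add_zero, ZMod.natCast_zmod_val]
  -- the two contributing classes
  set a : ZMod K := ((⌊u⌋ : ℤ) : ZMod K) with ha
  set b : ZMod K := ((⌊u⌋ + 1 : ℤ) : ZMod K) with hb
  have hab : a ≠ b := by
    rw [ha, hb]; push_cast
    intro h
    have : (1 : ZMod K) = 0 := by
      calc (1 : ZMod K) = ((⌊u⌋ : ℤ) : ZMod K) + 1 - ((⌊u⌋ : ℤ) : ZMod K) := by ring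
        _ = 0 := by rw [← h]; ring
    exact one_ne_zero this
  -- the integer of the class of an integer `j` with `−K/2 ≤ u − j < K/2` is `j` itself
  have hJ_of : ∀ j : ℤ, -((K : ℝ) / 2) ≤ u - j → u - j < K / 2 → J ((j : ℤ) : ZMod K) = j := by
    intro j hj1 hj2
    rw [hJ]
    show ((((j : ℤ) : ZMod K).val : ℕ) : ℤ) + (K : ℤ) * round ((u - ((((j : ℤ) : ZMod K).val : ℕ) : ℝ)) / (K : ℝ)) = j
    have hval : (((j : ℤ) : ZMod K).val : ℤ) = j % (K : ℤ) := ZMod.val_intCast j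
    have hdiv : j % (K : ℤ) + (K : ℤ) * (j / (K : ℤ)) = j := Int.emod_add_mul_ediv j K
    have hvalR : ((((j : ℤ) : ZMod K).val : ℕ) : ℝ) = ((j % (K : ℤ) : ℤ) : ℝ) := by exact_mod_cast hval
    rw [hval, hvalR]
    have hjZ : j = (K : ℤ) * (j / (K : ℤ)) + j % (K : ℤ) := by linarith [hdiv]
    have hjR : (j : ℝ) = (K : ℝ) * ((j / (K : ℤ) : ℤ) : ℝ) + ((j % (K : ℤ) : ℤ) : ℝ) := by exact_mod_cast hjZ
    have hround : round ((u - ((j % (K : ℤ) : ℤ) : ℝ)) / (K : ℝ)) = j / (K : ℤ) := by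
      rw [show (u - ((j % (K : ℤ) : ℤ) : ℝ)) / (K : ℝ) = (u - j) / K + ((j / (K : ℤ) : ℤ) : ℝ) by rw [hjR]; field_simp; ring, round_add_intCast,
        round_eq_zero_iff.2, zero_add]
      exact ⟨by rw [le_div_iff₀ hKr]; linarith, by rw [div_lt_iff₀ hKr]; linarith⟩
    rw [hround]
    linarith [hdiv]
  have hfl := Int.floor_le u
  have hfl1 := Int.lt_floor_add_one u
  have hu0a : -((K : ℝ) / 2) ≤ u - (⌊u⌋ : ℤ) := by linarith
  have hu0b : u - (⌊u⌋ : ℤ) < K / 2 := by linarith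
  have hu1a : -((K : ℝ) / 2) ≤ u - ((⌊u⌋ + 1 : ℤ) : ℝ) := by push_cast; linarith
  have hu1b : u - ((⌊u⌋ + 1 : ℤ) : ℝ) < K / 2 := by push_cast; linarith
  rw [Finset.sum_eq_add_of_mem a b (Finset.mem_univ _) (Finset.mem_univ _) hab]
  · rw [hsummand, hsummand, ha, hb, hJ_of _ hu0a hu0b, hJ_of _ hu1a hu1b]
    push_cast
    rw [show u - ((⌊u⌋ : ℝ) + 1) = u - ⌊u⌋ - 1 by ring]
    exact thetaP_partition u
  · intro k _ hk
    rw [hsummand]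
    have hz : thetaP (u - (J k : ℝ)) = 0 := by
      by_contra hne
      rcases thetaP_sub_int_ne_zero hne with h | h
      · exact hk.1 (by rw [← hcastJ k, h])
      · exact hk.2 (by rw [← hcastJ k, h])
    rw [hz]; ring

end Summit.QuantumFields.YangMills.BalabanUVNodes.N15.Gluing

end
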